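import Literature.IUT.HodgeArakelov.LabelClassesOfCuspsRmk241MaximalProL
import HarnessLib

/-!
# [IUTchII] Rmk 2.4.1 «its MAXIMAL pro-`l′` subgroup»: the subgroup of F-2063's decision IS pro-`l′` and is the GREATEST pro-`l′` subgroup of
# `I_t` (proof-only sequel of `LabelClassesOfCuspsRmk241MaximalProL.lean`, 0 defs)

S. Mochizuki, *Inter-universal Teichmüller Theory II*, kurims manuscript (Dec. 2020), §2, Remark 2.4.1, p. 71: «one may replace “`I_t`” in
Corollary 2.4 by its maximal pro-`l′` subgroup for any `l′ ∈ 𝔓𝔯𝔦𝔪𝔢𝔰 \ {p_v}` … involving intersections with other closed subgroups, since every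
closed subgroup of such a maximal pro-`l′` subgroup is either open or trivial.» ([IUTchII] Rmk 2.4.1, kurims p.71) [cite: Mochizuki2012, II Rmk 2.4.1 p.71]
[claim: Mochizuki2012, status: disputed] (D-0012 claim key; classical profinite group theory; nothing of the series is asserted).  abc-iut cell,
F6 row F-2063, node IUTchII:Rmk2.4.1; seat abc-iut-L6-t19 gen 7.  PROOF-ONLY.

THE POINT.  `LabelClassesOfCuspsRmk241MaximalProL.lean` (p454936) decides F-2063 for the subgroup `Λ ≤ I` (`I ≃ₜ* Ẑ`) singled out by the tree's
pro-`l` PART predicate of abc-iut-L5-t11 (`x ∈ Λ ⇔ x ∈ I ∧ ∀ open normal W ≤ I, ∃ n, x^{l^n} ∈ W`).  This file records, in the kernel, that this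
`Λ` deserves print's name «the maximal pro-`l′` subgroup of `I_t`» in the tree's own sense of pro-`Σ` ([CombGC] Def 1.1 (ii),
`SemiGraphs.IsProSigma`): `Λ` IS pro-`{l}` (`isProSigma_maximalProL_of_equiv_zHat`, abc-iut-L5-t11's `isProSigma_of_forall_exists_pow_mem`
transported to `Λ ≤ G`) and every pro-`{l}` subgroup of `G` inside `I` is contained in `Λ` (`le_maximalProL_of_isProSigma`: the trace `V` on
`Λ′` of an open normal `W ≤ I` has finite `l`-power index, so `x^{[Λ′:V]} ∈ V`), i.e. `Λ` is the GREATEST element of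
`{Λ′ ≤ I | Λ′ pro-{l}}` (`isGreatest_maximalProL_of_equiv_zHat`).  No new `def`; nothing of another seat's file is edited; no side taken on
[IUTchIII] Cor. 3.12.
-/

noncomputable section

namespace Literature.IUT.HodgeArakelov

open Literature.AnabelianGeometry.SemiGraphs (IsProSigma)
open Literature.IUT.HodgeTheaters

universe u

variable {G : Type u} [Group G] [TopologicalSpace G]

/-- A subgroup `I ≃ₜ* Ẑ` is compact and totally disconnected (as a subspace). [cite: MochizukiSemiAnbd2006, §6 p.71] -/
private theorem compactSpace_and_totallyDisconnectedSpace_of_equiv_zHat {I : Subgroup G}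
    (e : ↥I ≃ₜ* Literature.AnabelianGeometry.SemiGraphs.ZHat) : CompactSpace ↥I ∧ TotallyDisconnectedSpace ↥I :=
  ⟨e.toHomeomorph.symm.compactSpace,
    ⟨isTotallyDisconnected_of_image e.continuous.continuousOn e.injective
      (isTotallyDisconnected_of_totallyDisconnectedSpace _)⟩⟩

/-- **«its maximal pro-`l′` subgroup» IS pro-`l′`** ([CombGC] Def 1.1 (ii) sense, `SemiGraphs.IsProSigma {l}`): for `I ≤ G` with `I ≃ₜ* Ẑ` and
`Λ ≤ I` the pro-`l` part of `I` read in `G`, every finite discrete quotient of `Λ` (subspace topology from `G`) is an `l`-group — abc-iut-L5-t11's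
`isProSigma_of_forall_exists_pow_mem` for the profinite `I`, transported along `Λ.subgroupOf I ≅ Λ`. ([IUTchII] Rmk 2.4.1, kurims p.71)
[cite: Mochizuki2012, II Rmk 2.4.1 p.71] [claim: Mochizuki2012, status: disputed] -/
theorem isProSigma_maximalProL_of_equiv_zHat [IsTopologicalGroup G] {I : Subgroup G}
    (e : ↥I ≃ₜ* Literature.AnabelianGeometry.SemiGraphs.ZHat) {l : ℕ} [hl : Fact l.Prime] {Λ : Subgroup G} (hΛI : Λ ≤ I)
    (hΛ : ∀ x : ↥I, (x : G) ∈ Λ ↔ ∀ W : OpenNormalSubgroup ↥I, ∃ n : ℕ, x ^ l ^ n ∈ W.toSubgroup) :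
    IsProSigma {l} ↥Λ := by
  obtain ⟨hc, hd⟩ := compactSpace_and_totallyDisconnectedSpace_of_equiv_zHat e
  haveI := hc
  haveI := hd
  -- `Λ` read in `I` is pro-`l`
  have hQ : IsProSigma {l} ↥(Λ.subgroupOf I) :=
    isProSigma_of_forall_exists_pow_mem hl.out (Set.mem_singleton l) (Λ.subgroupOf I)
      fun x hx => (hΛ x).mp (Subgroup.mem_subgroupOf.mp hx)
  -- transport along the continuous surjection `Λ.subgroupOf I → Λ`
  refine isProSigma_of_surjective hQ (Subgroup.subgroupOfEquivOfLe hΛI).toMonoidHom ?_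
    (Subgroup.subgroupOfEquivOfLe hΛI).surjective
  exact (continuous_subtype_val.comp continuous_subtype_val).subtype_mk _

/-- **… and it contains EVERY pro-`l′` subgroup of `I`**: if `Λ′ ≤ I` is pro-`{l}` (subspace topology from `G`), then `Λ′ ≤ Λ`.  [For `x ∈ Λ′` and
an open normal `W ≤ I`, the trace `V := W ∩ Λ′` is an open normal subgroup of `Λ′` of finite index — `I ≃ₜ* Ẑ` is compact —, that index is a power
`l^k` by pro-`l`-ness, and `x^{l^k} ∈ V ≤ W`.] ([IUTchII] Rmk 2.4.1, kurims p.71) [cite: Mochizuki2012, II Rmk 2.4.1 p.71]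
[claim: Mochizuki2012, status: disputed] -/
theorem le_maximalProL_of_isProSigma [IsTopologicalGroup G] {I : Subgroup G}
    (e : ↥I ≃ₜ* Literature.AnabelianGeometry.SemiGraphs.ZHat) {l : ℕ} [Fact l.Prime] {Λ : Subgroup G}
    (hΛ : ∀ x : ↥I, (x : G) ∈ Λ ↔ ∀ W : OpenNormalSubgroup ↥I, ∃ n : ℕ, x ^ l ^ n ∈ W.toSubgroup)
    {Λ' : Subgroup G} (hΛ'I : Λ' ≤ I) (hΛ' : IsProSigma {l} ↥Λ') : Λ' ≤ Λ := by
  obtain ⟨hc, -⟩ := compactSpace_and_totallyDisconnectedSpace_of_equiv_zHat e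
  haveI := hc
  intro x hx
  refine (hΛ ⟨x, hΛ'I hx⟩).mpr fun W => ?_
  -- the inclusion `Λ' → I` and the trace `V` of `W` on `Λ'`
  let f : ↥Λ' →* ↥I := Subgroup.inclusion hΛ'I
  have hf : Continuous f := continuous_inclusion hΛ'I
  let V : OpenNormalSubgroup ↥Λ' :=
    { toOpenSubgroup := W.toOpenSubgroup.comap f hf
      isNormal' := Subgroup.Normal.comap inferInstance _ }
  -- `V` has finite index, a power of `l`
  haveI : W.toSubgroup.FiniteIndex := by
    haveI : Finite (↥I ⧸ W.toSubgroup) := Subgroup.quotient_finite_of_isOpen _ W.toOpenSubgroup.isOpen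
    exact Subgroup.finiteIndex_of_finite_quotient
  have hVidx : V.toSubgroup.index ≠ 0 := by
    change (W.toSubgroup.comap f).index ≠ 0
    rw [Subgroup.index_comap]
    exact Subgroup.FiniteIndex.index_ne_zero
  haveI : V.toSubgroup.FiniteIndex := ⟨hVidx⟩
  have hpow : ∃ k : ℕ, V.toSubgroup.index = l ^ k := by
    refine ⟨_, Nat.eq_prime_pow_of_unique_prime_dvd hVidx fun {d} hd hdvd => ?_⟩
    exact Set.mem_singleton_iff.mp (hΛ'.prime_mem V inferInstance d hd hdvd)
  obtain ⟨k, hk⟩ := hpow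
  refine ⟨k, ?_⟩
  -- `x ^ l^k ∈ V`, i.e. its image lies in `W`
  haveI : V.toSubgroup.Normal := V.isNormal'
  have hmem : (⟨x, hx⟩ : ↥Λ') ^ l ^ k ∈ V.toSubgroup := by
    rw [← hk]
    exact Subgroup.pow_index_mem V.toSubgroup _
  have hmem' : f ((⟨x, hx⟩ : ↥Λ') ^ l ^ k) ∈ W.toSubgroup := hmem
  rwa [map_pow] at hmem'

/-- **«the maximal pro-`l′` subgroup of `I_t`», literally**: for `I ≤ G` with `I ≃ₜ* Ẑ` and any prime `l`, the subgroup `Λ` of F-2063's decision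
(pro-`l` part of `I`) is the GREATEST element of `{Λ′ | Λ′ ≤ I ∧ Λ′ is pro-{l}}`. ([IUTchII] Rmk 2.4.1, kurims p.71) [cite: Mochizuki2012, II Rmk 2.4.1 p.71]
[claim: Mochizuki2012, status: disputed] -/
theorem isGreatest_maximalProL_of_equiv_zHat [IsTopologicalGroup G] {I : Subgroup G}
    (e : ↥I ≃ₜ* Literature.AnabelianGeometry.SemiGraphs.ZHat) {l : ℕ} [Fact l.Prime] {Λ : Subgroup G} (hΛI : Λ ≤ I)
    (hΛ : ∀ x : ↥I, (x : G) ∈ Λ ↔ ∀ W : OpenNormalSubgroup ↥I, ∃ n : ℕ, x ^ l ^ n ∈ W.toSubgroup) :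
    IsGreatest {Λ' : Subgroup G | Λ' ≤ I ∧ IsProSigma {l} ↥Λ'} Λ :=
  ⟨⟨hΛI, isProSigma_maximalProL_of_equiv_zHat e hΛI hΛ⟩,
    fun _ h => le_maximalProL_of_isProSigma e hΛ h.1 h.2⟩

end Literature.IUT.HodgeArakelov

end
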